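import Summits.HodgeConjecture.CorCM.MultiFieldWeilDihedralDecics
import Summits.HodgeConjecture.CorCM.MultiFieldWeilUnitsRankedSeparated
import HarnessLib

/-!
# MULTI-FIELD WEIL ENGINE — DECIC FIELDS OF BOTH KINDS IN ONE MENU: `E` + up to TWO non-isogenous fivefolds of `k`-signature `(2,3)` over each of several decic CM fields
# through `k`, each field having EITHER `2`-transitive quintic part (degree `40`) OR dihedral quintic part (closure degree `≤ 20`, an outside value, types free of common
# symmetries) — the Hodge conjecture for every product of copies, given only Markman's hyperbolic-sixfold theorem

Cell `pub-hodgecm2` (COR-CM), seat b30 gen 43 (2026-08-26); count-neutral own lane MULTI-FIELD WEIL ENGINE (stem `MultiFieldWeil*`), the MERGE (RUNBOOK-g42 κ1, decic part) of the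
`2`-transitive decic section of `CorCM/MultiFieldWeilUnitsMenu.lean` (gen 39: two `τ`-embeddings generating degree `40`) with the dihedral decic menu
`CorCM/MultiFieldWeilDihedralDecics.lean` (gen 42, primed form) through the engine with ABSTRACT per-unit separation (`hodgeConjectureFor_biproduct_comp_of_unitsSeparated_frames`):
per field the separation property is supplied by `unit_separated_of_twoTransitive` (U1: two distinct `2`-sets are `ℚ`-independent) or by `const_of_signed_realisedTuples_of_dihedral`
(E5b), according to the KIND of the field.  Theorems only; no definition, no named fact, no `sorry`.  HONEST FRAMING: conditional ONLY on the displayed Markman binder `hM6`; `HC_CM` is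
NOT proved and not asserted.

**`hodgeConjectureFor_biproduct_comp_of_decicsTwoKinds`.**  Slots `is : Fin r → I` over DECIC CM fields `Kf i ⊇ iK i (k)`, `k = Kf i₀` imaginary quadratic, `E = A 0 ⊨ (k; {τ})`,
`B_m = A (m+1) ⊨ (K_{is m}; Φ (m+1))` with EXACTLY TWO members of `Φ (m+1)` over `τ`; at most TWO slots per field, pairwise NON-ISOGENOUS; for every field `K` carrying two slots,
EITHER (`2`-transitive kind) two `τ`-embeddings `s₀ ≠ t₀` of `K` with `[ℚ(τk, s₀K, t₀K) : ℚ] = 40`, OR (dihedral kind) `[L(K):ℚ] ≤ 20`, a `τ`-embedding value outside the field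
generated by another, and FREENESS (an automorphism of `ℂ` over `τ(k)` stabilising the types of both structures on the `τ`-embeddings fixes every `τ`-embedding — different axes on
the pentagon); `Hom(K_i, K_{i'}) = ∅` for different indices.  THEN the Hodge conjecture holds for EVERY product of copies `⨁_j A(κ j)` (+ dominated form), GIVEN ONLY Markman's
hyperbolic-sixfold theorem.  Cyclic quintic parts carry one structure (prime slots need no kind); the reach per field is exactly the commutant criterion of
`CorCM/MultiFieldWeilCommutantCriterion.lean` (F1) at the three decic images.
[cite: Markman2025SecantWeil, Thm 1.5.1] [cite: Shimura1998, §6.1 Corollary of Theorem 2, §8.4, §18.2 Lemma (i)] [cite: Lang2002, VI §1 Thm. 1.1 and V §2 Thm. 2.8; XIII §4]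
[cite: MoonenZarhin1995Duke, Thm. 2.4] [cite: Pohlmann1968, Thm 1] [cite: DixonMortimer1996, §1.4 Ex. 1.4.1–1.4.2; §1.6, Thm. 1.6A; §2.1; §3.3] [cite: Serre1977, §5.3] [cite: MumfordAV1970, §19]

## References
* [Markman2025SecantWeil] E. Markman, Cycles on abelian 2n-folds of Weil type from secant sheaves on abelian n-folds, Thm 1.5.1.  [Shimura1998] G. Shimura, *Abelian varieties with
  complex multiplication and modular functions*, §6.1, §8.4, §18.2.  [Lang2002] S. Lang, *Algebra*, GTM 211, V §2, VI §1, XIII §4.  [MoonenZarhin1995Duke] B. Moonen, Yu. Zarhin,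
  Duke Math. J. 77 (1995), Thm. 2.4.  [Pohlmann1968] H. Pohlmann, Ann. of Math. 88 (1968), Thm 1.  [DixonMortimer1996] J. D. Dixon, B. Mortimer, *Permutation Groups*, GTM 163.
  [Serre1977] J.-P. Serre, *Linear Representations of Finite Groups*, GTM 42, §5.3.  [MumfordAV1970] D. Mumford, *Abelian Varieties*, §19.
-/

noncomputable section

open CategoryTheory CategoryTheory.Limits NumberField IntermediateField

namespace Summit.HodgeConjecture.CorCM.MultiFieldWeil

open Finset
open Literature.AlgebraicGeometry Literature.AlgebraicGeometry.Motives Literature.AlgebraicGeometry.HodgeTheory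
open Literature.AlgebraicGeometry.ComplexMultiplication (IsCMTypeRealisation)
open Literature.AlgebraicTopology.SingularHomology
open Literature.NumberTheory.ComplexMultiplication
open Summit.HodgeConjecture.CorCM.Census.MultiFieldWeil

open scoped Classical

section DecicsTwoKinds

variable {I : Type} {r : ℕ} {Kf : I → Type} [∀ i, Field (Kf i)] [∀ i, NumberField (Kf i)] [∀ i, IsCMField (Kf i)]
  {i₀ : I} {is : Fin r → I} {τ : Kf i₀ →+* ℂ}
  {A : Fin (r + 1) → AbelianVariety ℂ} {Φ : ∀ j : Fin (r + 1), CMType (Kf (mfSlots i₀ is j))}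
  {ι : ∀ j, 𝓞 (Kf (mfSlots i₀ is j)) →+* End (A j)}
  {θ : ∀ j, Kf (mfSlots i₀ is j) →+* Module.End ℂ (complexBetti (A j).X 1)}

/-- **UP TO TWO NON-ISOGENOUS `(2,3)`-FIVEFOLDS OVER EACH OF SEVERAL DECIC CM FIELDS THROUGH `k` OF EITHER KIND (`2`-TRANSITIVE OR DIHEDRAL QUINTIC PART), TIMES THE CM CURVE —
GIVEN ONLY MARKMAN'S HYPERBOLIC-SIXFOLD THEOREM.**  See the module docstring.  `HC_CM` is NOT asserted. [cite: Markman2025SecantWeil, Thm 1.5.1]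
[cite: Shimura1998, §6.1 Corollary of Theorem 2, §8.4, §18.2] [cite: DixonMortimer1996, §1.4 Ex. 1.4.1–1.4.2; §1.6, Thm. 1.6A; §2.1; §3.3] [cite: Serre1977, §5.3]
[cite: Lang2002, VI §1 Thm. 1.1; XIII §4] -/
theorem hodgeConjectureFor_biproduct_comp_of_decicsTwoKinds (hM6 : Markman2025_weilClasses_algebraic_hyperbolicSixfold)
    {N : ℕ} (κ : Fin N → Fin (r + 1)) (h2 : Module.finrank ℚ (Kf i₀) = 2)
    (hdeg : ∀ m : Fin r, Module.finrank ℚ (Kf (is m)) = 10) (iK : ∀ i : I, Kf i₀ →+* Kf i)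
    (hA : ∀ j, IsCMTypeRealisation (Φ j) (A j) (ι j) (θ j)) (hΨ : ∀ σ : Kf i₀ →+* ℂ, σ ∈ (Φ 0).1 ↔ σ = τ)
    (h23 : ∀ m : Fin r, (Finset.univ.filter fun s : Kf (is m) →+* ℂ => s.comp (iK (is m)) = τ ∧ s ∈ (Φ m.succ).1).card = 2)
    (hfib : ∀ m : Fin r, (Finset.univ.filter fun m' : Fin r => is m' = is m).card ≤ 2)
    (hni : ∀ m m' : Fin r, m' ≠ m → is m' = is m → ¬ AbelianVariety.IsIsogenous (A m.succ) (A m'.succ))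
    (hquintic : ∀ m : Fin r, (∃ m', m' ≠ m ∧ is m' = is m) →
      (∃ s₀ t₀ : Kf (is m) →+* ℂ, s₀.comp (iK (is m)) = τ ∧ t₀.comp (iK (is m)) = τ ∧ s₀ ≠ t₀ ∧
        Module.finrank ℚ ↥(adjoin ℚ (Set.range τ) ⊔ adjoin ℚ (Set.range s₀ ∪ Set.range t₀)) = 40) ∨
      (Module.finrank ℚ ↥(normalClosure ℚ (Kf (is m)) ℂ) ≤ 20 ∧
        (∃ s₀ t₀ : Kf (is m) →+* ℂ, s₀.comp (iK (is m)) = τ ∧ t₀.comp (iK (is m)) = τ ∧ ∃ x, t₀ x ∉ adjoin ℚ (Set.range s₀)) ∧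
        ∀ ρ : ℂ ≃+* ℂ, (ρ : ℂ →+* ℂ).comp τ = τ →
          (∀ m', is m' = is m → ∀ s : Kf (is m') →+* ℂ, s.comp (iK (is m')) = τ → (s ∈ (Φ m'.succ).1 ↔ (ρ : ℂ →+* ℂ).comp s ∈ (Φ m'.succ).1)) →
          ∀ s : Kf (is m) →+* ℂ, s.comp (iK (is m)) = τ → (ρ : ℂ →+* ℂ).comp s = s))
    (hiso : ∀ m₀ m : Fin r, is m ≠ is m₀ → IsEmpty (Kf (is m) →+* Kf (is m₀))) :
    HodgeConjectureFor (⨁ fun j => A (κ j)).dim (⨁ fun j => A (κ j)).X := by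
  have hττ : ComplexEmbedding.conjugate τ ≠ τ := QuarticCM.conjugate_ne τ
  have hk : ∀ σ : Kf i₀ →+* ℂ, σ = τ ∨ σ = ComplexEmbedding.conjugate τ := fun σ => QuarticCM.eq_or_eq_conjugate_of_quadratic h2 τ σ
  obtain ⟨δ₀, d, hd, hδ₀⟩ := CyclicSextic.exists_sq_eq_neg_nat_of_isTotallyComplex (Kf i₀) h2
  obtain ⟨δ, hδ, hτ⟩ := OcticCurveFourfold.exists_delta_of_mem h2 hd hδ₀ τ
  let im : ∀ m : Fin r, Kf i₀ →+* Kf (is m) := fun m => iK (is m)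
  have hdeg' : ∀ m : Fin r, Module.finrank ℚ (Kf (is m)) = 2 * 5 := fun m => by rw [hdeg m]
  -- (1) the units: a representative map for the fibres of `is`
  obtain ⟨U, hU⟩ := exists_unitRep is
  have hcardU : ∀ m, Fintype.card {m' : Fin r // U m' = U m} = (Finset.univ.filter fun m' : Fin r => is m' = is m).card := fun m => by
    rw [Fintype.card_subtype]; exact congrArg Finset.card (Finset.ext fun x => by simp only [Finset.mem_filter, Finset.mem_univ, true_and, hU])
  -- (2) ONE SIGN FRAME PER INDEX
  have hfr : ∀ i : I, Module.finrank ℚ (Kf i) = 2 * 5 → ∃ E : (Kf i →+* ℂ) ≃ Fin 5 × Bool,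
      (∀ s, (E s).2 = true ↔ s.comp (iK i) = τ) ∧ ∀ s, E (ComplexEmbedding.conjugate s) = ((E s).1, !(E s).2) := fun i hdi => exists_signFrame hdi h2 (iK i) hττ hk
  choose E hE_sign hE_conj using hfr
  have diagT : ∀ i j : I, ∀ h : i = j, ∀ (hi : Module.finrank ℚ (Kf i) = 2 * 5) (hj : Module.finrank ℚ (Kf j) = 2 * 5) (ρ : ℂ →+* ℂ) (a x y : Fin 5),
      ρ.comp ((E i hi).symm (a, true)) = (E i hi).symm (x, true) → ρ.comp ((E j hj).symm (a, true)) = (E j hj).symm (y, true) → x = y := by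
    intro i j h; subst h; intro hi hj ρ a x y h₁ h₂
    exact congrArg Prod.fst ((E i hi).symm.injective (h₁.symm.trans h₂))
  -- (3) the frames of the slots, their readings and position sets (all of size `5`)
  let e : ∀ m : Fin r, (Kf (is m) →+* ℂ) ≃ Fin 5 × Bool := fun m => E (is m) (hdeg' m)
  have he_sign : ∀ (m : Fin r) (s : Kf (is m) →+* ℂ), (e m s).2 = true ↔ s.comp (im m) = τ := fun m => hE_sign (is m) (hdeg' m)
  have he_conj : ∀ (m : Fin r) (s : Kf (is m) →+* ℂ), e m (ComplexEmbedding.conjugate s) = ((e m s).1, !(e m s).2) := fun m => hE_conj (is m) (hdeg' m)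
  let P : ∀ _ : Fin r, Finset (Fin 5) := fun m => Finset.univ.filter fun a : Fin 5 => (e m).symm (a, true) ∈ (Φ m.succ).1
  have hΦ : ∀ (m : Fin r) (s : Kf (is m) →+* ℂ), s ∈ (Φ m.succ).1 ↔ (e m s).2 = decide ((e m s).1 ∈ P m) := fun m s =>
    mem_iff_snd_eq_decide_mem_posSet (he_conj m) (Φ m.succ) s
  have hcard : ∀ m : Fin r, (P m).card = 2 := fun m => (card_posSet (he_sign m) (Φ m.succ)).trans (h23 m)
  have hmemP : ∀ (m : Fin r) (a : Fin 5), a ∈ P m ↔ (e m).symm (a, true) ∈ (Φ m.succ).1 := fun m a => by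
    simp only [P, Finset.mem_filter, Finset.mem_univ, true_and]
  have hsymm_sign : ∀ (m : Fin r) (a : Fin 5), ((e m).symm (a, true)).comp (im m) = τ := fun m a => (he_sign m _).1 (by simp)
  -- (4) the realised tuples are DIAGONAL on every unit
  have hn : ∀ m m' : Fin r, U m' = U m → (5 : ℕ) = 5 := fun _ _ _ => rfl
  have hdg0 : ∀ π ∈ realisedTuples e τ, ∀ (m m' : Fin r), U m' = U m → ∀ a : Fin 5, π m' a = π m a := by
    intro π hπ m m' h a; obtain ⟨ρ, -, hρ⟩ := (mem_realisedTuples e τ π).1 hπ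
    exact diagT _ _ ((hU m m').1 h) (hdeg' m') (hdeg' m) (ρ : ℂ →+* ℂ) a (π m' a) (π m a) (hρ m' a) (hρ m a)
  have hdg : ∀ π ∈ realisedTuples e τ, ∀ (m m' : Fin r) (h : U m' = U m) (a : Fin 5), Fin.cast (hn m m' h) (π m' a) = π m (Fin.cast (hn m m' h) a) := by
    intro π hπ m m' h a
    have e1 : Fin.cast (hn m m' h) (π m' a) = π m' a := Fin.ext rfl
    have e2 : Fin.cast (hn m m' h) a = a := Fin.ext rfl
    rw [e1, e2]; exact hdg0 π hπ m m' h a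
  -- (5) stabiliser-transitivity across units: `Hom = ∅` between different decic fields gives a value outside the closure; prime size `5`
  have hexs : ∀ m : Fin r, ∃ s : Kf (is m) →+* ℂ, s.comp (im m) = τ := fun m => ⟨(e m).symm (0, true), hsymm_sign m 0⟩
  have hout : ∀ m₀ m : Fin r, is m ≠ is m₀ → ∃ s : Kf (is m) →+* ℂ, s.comp (im m) = τ ∧ ∃ x, s x ∉ normalClosure ℚ (Kf (is m₀)) ℂ := by
    intro m₀ m hne; obtain ⟨s, hs⟩ := hexs m
    exact ⟨s, hs, exists_apply_not_mem_normalClosure_of_isEmpty_ringHom_five h2 im (hdeg m₀) (hdeg m) (hiso m₀ m hne) s hs⟩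
  have hstab₀ : ∀ (m₀ m : Fin r), is m ≠ is m₀ → ∀ a a' : Fin 5, ∃ ν ∈ realisedTuples e τ, ν m₀ = 1 ∧ ν m a = a' := fun m₀ m hne a a' =>
    stabTransitive_realisedTuples_of_outside_prime (e := e) he_sign m₀ m Nat.prime_five (hout m₀ m hne) a a'
  have hstab : ∀ (m₀ m : Fin r), U m₀ ≠ U m → ∀ a a' : Fin 5, ∃ ν ∈ realisedTuples e τ, (∀ m', U m' = U m₀ → ν m' = 1) ∧ ν m a = a' := by
    intro m₀ m hne a a'
    obtain ⟨ν, hν, hν0, hνa⟩ := hstab₀ m₀ m (fun h => hne ((hU m m₀).2 h.symm)) a a'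
    refine ⟨ν, hν, fun m' hm' => Equiv.ext fun b => ?_, hνa⟩
    have hb := hdg0 ν hν m₀ m' hm' b
    rw [hν0] at hb
    exact hb
  -- (6) the slot menu on the single slots: prime size
  have hkind : ∀ m : Fin r, (∀ m', U m' = U m → m' = m) → (5 : ℕ).Prime ∨ (2 : ℕ) = 1 ∨
      ∀ Q : Finset (Fin 5), Q.card = 2 → ∃ π ∈ realisedTuples e τ, preG (π m) (P m) = Q := fun m _ => Or.inl Nat.prime_five
  -- (7) transport of the partner structure of a unit to the slot's own field; distinct position sets by non-isogeny (Shimura)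
  have castT : ∀ i j : I, i = j → ∀ (Ψ : CMType (Kf i)) (B : AbelianVariety ℂ) (ιB : 𝓞 (Kf i) →+* End B)
      (θB : Kf i →+* Module.End ℂ (complexBetti B.X 1)), IsCMTypeRealisation Ψ B ιB θB →
      ∀ (hi : Module.finrank ℚ (Kf i) = 2 * 5) (hj : Module.finrank ℚ (Kf j) = 2 * 5) (Q : Finset (Fin 5)),
      (∀ s, s ∈ Ψ.1 ↔ (E i hi s).2 = decide ((E i hi s).1 ∈ Q)) →
      ∃ (Ψ₂ : CMType (Kf j)) (ι₂ : 𝓞 (Kf j) →+* End B) (θ₂ : Kf j →+* Module.End ℂ (complexBetti B.X 1)), IsCMTypeRealisation Ψ₂ B ι₂ θ₂ ∧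
        ∀ s, s ∈ Ψ₂.1 ↔ (E j hj s).2 = decide ((E j hj s).1 ∈ Q) := by
    intro i j h; subst h; intro Ψ B ιB θB hB hi hj Q hr; exact ⟨Ψ, ιB, θB, hB, hr⟩
  have hdist : ∀ m m' : Fin r, m' ≠ m → is m' = is m → P m' ≠ P m := by
    intro m m' hne h heq
    obtain ⟨Ψ₂, ι₂, θ₂, hA₂, hr₂⟩ := castT (is m') (is m) h (Φ m'.succ) (A m'.succ) (ι m'.succ) (θ m'.succ) (hA m'.succ) (hdeg' m') (hdeg' m) (P m') (hΦ m')
    have hsh := DihedralSexticPair.cmType_ne_and_ne_compl_of_not_isIsogenous (hA m.succ) hA₂ (hni m m' hne h)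
    exact hsh.1 (Set.ext fun s => (hΦ m s).trans (by rw [← heq]; exact (hr₂ s).symm))
  -- (8) THE SEPARATION PROPERTY OF EVERY UNIT WITH TWO SLOTS: `2`-transitive quintic part (U1) or dihedral quintic part (E5b)
  have hunit : ∀ m, (∃ m', m' ≠ m ∧ U m' = U m) → ∀ (u : {m' : Fin r // U m' = U m} → Fin 5 → ℤ) (w : ℤ),
      (∀ π ∈ realisedTuples e τ, (∑ i, ∑ x : Fin 5, (if π m x ∈ (P i.1).image (Fin.cast (hn m i.1 i.2)) then u i x else -u i x)) = w) →
      ∀ (i : {m' : Fin r // U m' = U m}) (a b : Fin 5), u i a = u i b := by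
    intro m hm u w hw
    obtain ⟨m', hm'm, hUm'⟩ := hm
    have him : is m' = is m := (hU m m').1 hUm'
    have hm' : ∃ m', m' ≠ m ∧ is m' = is m := ⟨m', hm'm, him⟩
    have hix : ∀ x : {x : Fin r // U x = U m}, is x.1 = is m := fun x => (hU m x.1).1 x.2
    have hι : Fintype.card {m' : Fin r // U m' = U m} ≤ 2 := by rw [hcardU m]; exact hfib m
    have hQcard : ∀ i : {m' : Fin r // U m' = U m}, ((P i.1).image (Fin.cast (hn m i.1 i.2))).card = 2 := fun i => by
      rw [Finset.card_image_of_injective _ (Fin.cast_injective _), hcard]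
    have hmemQ : ∀ (i : {m' : Fin r // U m' = U m}) (y : Fin 5), y ∈ (P i.1).image (Fin.cast (hn m i.1 i.2)) ↔ y ∈ P i.1 := fun i y => by
      rw [image_cast_self]
    rcases hquintic m hm' with ⟨s₀, t₀, hs₀, ht₀, hst₀, hd40⟩ | ⟨h20, hns, hfree⟩
    · -- `2`-TRANSITIVE QUINTIC PART: U1 through E13's `unit_separated_of_twoTransitive`
      have h2t : ∀ a a' b b' : Fin 5, a ≠ a' → b ≠ b' → ∃ π ∈ realisedTuples e τ, π m a = b ∧ π m a' = b' := fun a a' b b' haa hbb =>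
        twoTransitive_realisedTuples_of_aut (e := e) he_sign m
          (twoTransitive_aut_of_finrank_pair h2 im m (nm := 5) (hdeg' m) hs₀ ht₀ hst₀ (by rw [hd40])) a a' b b' haa hbb
      -- the unit has exactly the two members `m`, `m'`
      have hmemF : ∀ x : {x : Fin r // U x = U m}, x.1 ∈ Finset.univ.filter fun y : Fin r => is y = is m := fun x => by
        simp only [Finset.mem_filter, Finset.mem_univ, true_and]; exact hix x
      have huniv : ∀ x : {x : Fin r // U x = U m}, x = ⟨m, rfl⟩ ∨ x = ⟨m', hUm'⟩ := by
        intro x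
        have hF : ({m, m'} : Finset (Fin r)) = Finset.univ.filter fun y : Fin r => is y = is m :=
          Finset.eq_of_subset_of_card_le (fun y hy => by
              simp only [Finset.mem_insert, Finset.mem_singleton] at hy; simp only [Finset.mem_filter, Finset.mem_univ, true_and]
              rcases hy with rfl | rfl; exacts [rfl, him])
            (by rw [Finset.card_pair hm'm.symm]; exact hfib m)
        have hx := hmemF x
        rw [← hF, Finset.mem_insert, Finset.mem_singleton] at hx
        rcases hx with h | h
        exacts [Or.inl (Subtype.ext h), Or.inr (Subtype.ext h)]
      have hQeq : ∀ x : {x : Fin r // U x = U m}, (P x.1).image (Fin.cast (hn m x.1 x.2)) = P x.1 := fun x => image_cast_self _ _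
      have hli0 : LinearIndependent ℚ fun x : {x : Fin r // U x = U m} => fun q : Fin 5 =>
          ((5 : ℚ) * (if q ∈ (P x.1).image (Fin.cast (hn m x.1 x.2)) then 1 else 0) - ((P x.1).image (Fin.cast (hn m x.1 x.2))).card) := by
        refine linearIndependent_cells_of_two (k := 5) ⟨m, rfl⟩ ⟨m', hUm'⟩ (fun h => hm'm.symm (congrArg Subtype.val h)) huniv
          (fun x => (P x.1).image (Fin.cast (hn m x.1 x.2))) (fun x => Finset.card_pos.1 (by rw [hQcard]; norm_num))
          (fun x => by rw [hQcard]; norm_num) ?_ ?_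
        · rw [hQeq, hQeq]; exact hdist m m' hm'm him
        · rw [hQeq, hQeq]; intro h
          have hc := congrArg Finset.card h
          rw [Finset.card_compl, Fintype.card_fin, hcard, hcard] at hc
          norm_num at hc
      have hli : LinearIndependent ℚ fun x : {x : Fin r // U x = U m} => fun q : Fin 5 =>
          ((5 : ℚ) * (if q ∈ (P x.1).image (Fin.cast (hn m x.1 x.2)) then 1 else 0) - (P x.1).card) := by
        have hfun : (fun x : {x : Fin r // U x = U m} => fun q : Fin 5 =>
            ((5 : ℚ) * (if q ∈ (P x.1).image (Fin.cast (hn m x.1 x.2)) then 1 else 0) - (P x.1).card)) =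
            fun x : {x : Fin r // U x = U m} => fun q : Fin 5 =>
              ((5 : ℚ) * (if q ∈ (P x.1).image (Fin.cast (hn m x.1 x.2)) then 1 else 0) - ((P x.1).image (Fin.cast (hn m x.1 x.2))).card) := by
          funext x q; rw [Finset.card_image_of_injective _ (Fin.cast_injective _)]
        rw [hfun]; exact hli0
      exact unit_separated_of_twoTransitive (R := realisedTuples e τ) (P := P) (fun _ hπ _ hπ' => mul_mem_realisedTuples e τ hπ hπ') U hn m h2t
        (by exact_mod_cast hli) u w hw
    · -- DIHEDRAL QUINTIC PART: freeness read on the realised tuples, then E5b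
      have hfreeR : ∀ π ∈ realisedTuples e τ, (∀ (i : {m' : Fin r // U m' = U m}) (y : Fin 5), π m y ∈ (P i.1).image (Fin.cast (hn m i.1 i.2)) ↔
          y ∈ (P i.1).image (Fin.cast (hn m i.1 i.2))) → π m = 1 := by
        intro π hπ hst
        obtain ⟨ρ, hρτ, hρ⟩ := (mem_realisedTuples e τ π).1 hπ
        have hfix := hfree ρ hρτ (fun m' hm' s hs => by
          have hUm' : U m' = U m := (hU m m').2 hm'
          set a : Fin 5 := (e m' s).1 with ha
          have hs' : (e m').symm (a, true) = s := by
            rw [ha, show ((e m' s).1, true) = e m' s from Prod.ext rfl ((he_sign m' s).2 hs).symm, Equiv.symm_apply_apply]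
          have hρs : (ρ : ℂ →+* ℂ).comp s = (e m').symm (π m' a, true) := by rw [← hs']; exact hρ m' a
          have h1 : s ∈ (Φ m'.succ).1 ↔ a ∈ P m' := by rw [hmemP, hs']
          have h2' : (ρ : ℂ →+* ℂ).comp s ∈ (Φ m'.succ).1 ↔ π m' a ∈ P m' := by rw [hmemP, hρs]
          rw [h1, h2']
          have := hst ⟨m', hUm'⟩ a
          rw [hmemQ, hmemQ, ← hdg0 π hπ m m' hUm' a] at this
          exact this.symm)
        refine Equiv.ext fun y => ?_
        have hy := hfix ((e m).symm (y, true)) (hsymm_sign m y)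
        rw [hρ m y] at hy
        exact congrArg Prod.fst ((e m).symm.injective hy)
      exact const_of_signed_realisedTuples_of_dihedral (e := e) he_sign m rfl h2 h20 hns hι
        (fun i => (P i.1).image (Fin.cast (hn m i.1 i.2))) hQcard hfreeR u hw
  -- (9) the engine with separated units; the single-slot Weil spaces from Markman's sixfold theorem
  exact hodgeConjectureFor_biproduct_comp_of_unitsSeparated_frames (is := is) (n := fun _ => 5) P (fun _ => 2) hcard (fun _ => by norm_num) (fun _ => by norm_num)
    κ h2 im hτ hA e he_sign he_conj hΨ hΦ U hn hdg hstab hunit hkind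
    fun m => weilHyp_of_markman_sixfold_decic_intrinsic hM6 m (hdeg m) h2 hd hδ hA hΨ (h23 m)


/-- **Dominated form.** [cite: Markman2025SecantWeil, Thm 1.5.1] [cite: MumfordAV1970, §19 Thm. 1 and p. 169] -/
theorem hodgeConjectureFor_of_avDominatedBy_comp_of_decicsTwoKinds (hM6 : Markman2025_weilClasses_algebraic_hyperbolicSixfold)
    {N : ℕ} (κ : Fin N → Fin (r + 1)) (h2 : Module.finrank ℚ (Kf i₀) = 2)
    (hdeg : ∀ m : Fin r, Module.finrank ℚ (Kf (is m)) = 10) (iK : ∀ i : I, Kf i₀ →+* Kf i)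
    (hA : ∀ j, IsCMTypeRealisation (Φ j) (A j) (ι j) (θ j)) (hΨ : ∀ σ : Kf i₀ →+* ℂ, σ ∈ (Φ 0).1 ↔ σ = τ)
    (h23 : ∀ m : Fin r, (Finset.univ.filter fun s : Kf (is m) →+* ℂ => s.comp (iK (is m)) = τ ∧ s ∈ (Φ m.succ).1).card = 2)
    (hfib : ∀ m : Fin r, (Finset.univ.filter fun m' : Fin r => is m' = is m).card ≤ 2)
    (hni : ∀ m m' : Fin r, m' ≠ m → is m' = is m → ¬ AbelianVariety.IsIsogenous (A m.succ) (A m'.succ))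
    (hquintic : ∀ m : Fin r, (∃ m', m' ≠ m ∧ is m' = is m) →
      (∃ s₀ t₀ : Kf (is m) →+* ℂ, s₀.comp (iK (is m)) = τ ∧ t₀.comp (iK (is m)) = τ ∧ s₀ ≠ t₀ ∧
        Module.finrank ℚ ↥(adjoin ℚ (Set.range τ) ⊔ adjoin ℚ (Set.range s₀ ∪ Set.range t₀)) = 40) ∨
      (Module.finrank ℚ ↥(normalClosure ℚ (Kf (is m)) ℂ) ≤ 20 ∧
        (∃ s₀ t₀ : Kf (is m) →+* ℂ, s₀.comp (iK (is m)) = τ ∧ t₀.comp (iK (is m)) = τ ∧ ∃ x, t₀ x ∉ adjoin ℚ (Set.range s₀)) ∧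
        ∀ ρ : ℂ ≃+* ℂ, (ρ : ℂ →+* ℂ).comp τ = τ →
          (∀ m', is m' = is m → ∀ s : Kf (is m') →+* ℂ, s.comp (iK (is m')) = τ → (s ∈ (Φ m'.succ).1 ↔ (ρ : ℂ →+* ℂ).comp s ∈ (Φ m'.succ).1)) →
          ∀ s : Kf (is m) →+* ℂ, s.comp (iK (is m)) = τ → (ρ : ℂ →+* ℂ).comp s = s))
    (hiso : ∀ m₀ m : Fin r, is m ≠ is m₀ → IsEmpty (Kf (is m) →+* Kf (is m₀)))
    {X : AbelianVariety ℂ} (hX : Domination.AVDominatedBy X (⨁ fun j => A (κ j))) : HodgeConjectureFor X.dim X.X :=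
  Domination.hodgeConjectureFor_of_avDominatedBy
    (hodgeConjectureFor_biproduct_comp_of_decicsTwoKinds hM6 κ h2 hdeg iK hA hΨ h23 hfib hni hquintic hiso) hX

end DecicsTwoKinds

end Summit.HodgeConjecture.CorCM.MultiFieldWeil

end
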